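import Summits.CriticalPhenomena.PercolationContinuityZ3.Theorems.SahiLiebSahiContinuumProduct
import Literature.Combinatorics.Sahi2008.LebesgueLevelSets

/-!
# Lieb–Sahi's Theorem 3.5 / Corollary 3.6 for EVERY product probability measure on `[0,1]^k`
# (cell `prim-sahi`, typer seat; `--supports stmt-CriticalPhenomena-4575`)

[LiebSahi2021, Thm. 3.5 / Cor. 3.6] (tree: `Literature.Combinatorics.Sahi2008.liebSahi_thm35_volume`,
`Literature.Combinatorics.Sahi2008.liebSahi_cor36`): for LEBESGUE measure on `Q_k = [0,1]^k` and every `n`,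
`E_n(f^1,…,f^n) ≥ 0` when the `f^i` are characteristic functions of `k`-rectangles `[0,r_1] × ⋯ × [0,r_k]`, or
positive functions all of whose upper level sets are such rectangles.  THIS FILE: the same holds for EVERY product
probability measure `μ_1 ⊗ ⋯ ⊗ μ_k` on `Q_k` (arbitrary Borel probability measures `μ_j` on `[0,1]`, atoms and singular
parts allowed).  Mechanism: the coordinatewise quantile transform `G(u) = (G_j(u_j))_j` of
`SahiLiebSahiContinuumProduct.lean` pushes Lebesgue measure to `⊗ μ_j` (`measurePreserving_quantilePi`), and by the Galois
property `G_j(u) ≤ x ↔ u ≤ F_j(x)` (`UnitIntervalQuantile.quantile_le_iff`) the preimage of a rectangle is again a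
(closed) rectangle, `G⁻¹([0,r_1] × ⋯ × [0,r_k]) = [0,F_1(r_1)] × ⋯ × [0,F_k(r_k)]` (`preimage_quantilePi_rect`); so a
function with rectangular upper level sets pulls back to one, and `E_n` is invariant under measure-preserving maps.

* `LebesgueBoxes.measurable_of_levelSets` — a nonnegative function whose upper level sets are rectangles or empty is
  Borel measurable.
* `measurePreserving_quantilePi` — the coordinatewise quantile transform `(Q_κ, λ) → (Q_κ, ⊗ μ_j)` (any finite `κ`).
* **`msahiE_pi_nonneg_of_rectLevelSets`** — Cor. 3.6 for every product probability measure on `Q_κ`, every `n`.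
* **`msahiE_pi_indicator_rect_nonneg`** — Thm. 3.5 for every product probability measure on `Q_κ`, every `n`.

New mathematics (in print: the Lebesgue case); standard ingredients.  No conjecture enters; no definitions; axioms
standard.
-/

namespace Summit.CriticalPhenomena.PercolationContinuityZ3.Theorems

open MeasureTheory Set Filter Topology Literature.Combinatorics.Sahi2008
open Literature.Combinatorics.Sahi2008.LebesgueBoxes
open scoped unitInterval

namespace SahiRectangles

variable {κ : Type*}

/-- **A nonnegative function on `Q_κ` whose upper level sets are rectangles (or empty) is Borel measurable** (its
upper level sets are closed boxes, empty, or — below `0` — everything). [folklore] -/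
theorem measurable_of_levelSets [Finite κ] {φ : (κ → I) → ℝ} (h0 : ∀ x, 0 ≤ φ x)
    (hlev : ∀ t : ℝ, 0 ≤ t → (∃ r, {x | t < φ x} = rect r) ∨ {x | t < φ x} = ∅) : Measurable φ := by
  refine measurable_of_Ioi fun t => ?_
  change MeasurableSet {x | t < φ x}
  by_cases ht : 0 ≤ t
  · rcases hlev t ht with ⟨r, hr⟩ | h
    · rw [hr]
      have e : rect r = Set.pi Set.univ fun j => Set.Iic (r j) := by
        ext x
        simp only [rect, Set.mem_setOf_eq, Set.mem_pi, Set.mem_univ, true_implies, Set.mem_Iic]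
      rw [e]
      exact MeasurableSet.pi Set.countable_univ fun j _ => measurableSet_Iic
    · rw [h]
      exact MeasurableSet.empty
  · have e : {x | t < φ x} = Set.univ := Set.eq_univ_of_forall fun x => lt_of_lt_of_le (lt_of_not_ge ht) (h0 x)
    rw [e]
    exact MeasurableSet.univ

variable [Fintype κ] (μ : κ → Measure I) [∀ j, IsProbabilityMeasure (μ j)]

/-- **The coordinatewise quantile transform pushes Lebesgue measure on `Q_κ` to the product measure `⊗_j μ_j`.**
[folklore] -/
theorem measurePreserving_quantilePi :
    MeasurePreserving (fun (u : κ → I) (j : κ) => UnitIntervalQuantile.quantile (μ j) (u j))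
      (volume : Measure (κ → I)) (Measure.pi μ) :=
  measurePreserving_pi (fun _ : κ => (volume : Measure I)) μ
    fun j => UnitIntervalQuantile.measurePreserving_quantile (μ j)

omit [Fintype κ] in
/-- The distribution-function value `F_j(t)` lies in `[0,1]`. [folklore] -/
theorem cdf_mem_unitInterval (j : κ) (t : ℝ) : UnitIntervalQuantile.cdf (μ j) t ∈ I :=
  ⟨UnitIntervalQuantile.cdf_nonneg (μ j) t, UnitIntervalQuantile.cdf_le_one (μ j) t⟩

omit [Fintype κ] in
/-- **Rectangles pull back to rectangles** under the coordinatewise quantile transform: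
`G⁻¹([0,r_1] × ⋯ × [0,r_k]) = [0,F_1(r_1)] × ⋯ × [0,F_k(r_k)]` (Galois property `G_j(u) ≤ x ↔ u ≤ F_j(x)`). [folklore] -/
theorem preimage_quantilePi_rect (r : κ → I) :
    (fun (u : κ → I) (j : κ) => UnitIntervalQuantile.quantile (μ j) (u j)) ⁻¹' rect r =
      rect fun j => ⟨UnitIntervalQuantile.cdf (μ j) (r j), cdf_mem_unitInterval μ j (r j)⟩ := by
  ext u
  simp only [Set.mem_preimage, rect, Set.mem_setOf_eq, UnitIntervalQuantile.quantile_le_iff]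
  exact forall_congr' fun j => Iff.rfl

/-- **Lieb–Sahi's Corollary 3.6 for every product probability measure on `[0,1]^k`, every `n`**: for arbitrary
Borel probability measures `μ_j` on `[0,1]` and nonnegative `f^1,…,f^n : Q_κ → ℝ` all of whose upper level sets
`{f^i > t}` (`t ≥ 0`) are `k`-rectangles `[0,r_1] × ⋯ × [0,r_k]` or empty, `0 ≤ E_n(f^1,…,f^n)` under `⊗_j μ_j`.
[this work; cite: LiebSahi2021, Cor. 3.6 (Lebesgue case)] -/
theorem msahiE_pi_nonneg_of_rectLevelSets (n : ℕ) (f : Fin n → (κ → I) → ℝ) (hf0 : ∀ i x, 0 ≤ f i x)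
    (hlev : ∀ i (t : ℝ), 0 ≤ t → (∃ r, {x | t < f i x} = rect r) ∨ {x | t < f i x} = ∅) :
    0 ≤ msahiE (Measure.pi μ) n f := by
  set G : (κ → I) → κ → I := fun u j => UnitIntervalQuantile.quantile (μ j) (u j) with hG
  rw [← msahiE_comp_measurePreserving_of_measurable (measurePreserving_quantilePi μ) n f
    fun i => measurable_of_levelSets (hf0 i) (hlev i)]
  refine liebSahi_cor36 n _ (fun i u => hf0 i _) fun i t ht => ?_
  rcases hlev i t ht with ⟨r, hr⟩ | h
  · refine Or.inl ⟨fun j => ⟨UnitIntervalQuantile.cdf (μ j) (r j), cdf_mem_unitInterval μ j (r j)⟩, ?_⟩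
    change G ⁻¹' {x | t < f i x} = _
    rw [hr]
    exact preimage_quantilePi_rect μ r
  · refine Or.inr ?_
    change G ⁻¹' {x | t < f i x} = ∅
    rw [h, Set.preimage_empty]

/-- **Lieb–Sahi's Theorem 3.5 for every product probability measure on `[0,1]^k`, every `n`**: for arbitrary Borel
probability measures `μ_j` on `[0,1]` and corners `r^1,…,r^n ∈ Q_κ`, `0 ≤ E_n(χ_{R(r^1)},…,χ_{R(r^n)})` under
`⊗_j μ_j`, `R(r) = [0,r_1] × ⋯ × [0,r_k]`. [this work; cite: LiebSahi2021, Thm. 3.5 (Lebesgue case)] -/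
theorem msahiE_pi_indicator_rect_nonneg (n : ℕ) (r : Fin n → κ → I) :
    0 ≤ msahiE (Measure.pi μ) n fun i => (rect (r i)).indicator (1 : (κ → I) → ℝ) := by
  refine msahiE_pi_nonneg_of_rectLevelSets μ n _ (fun i x => Set.indicator_nonneg (fun _ _ => zero_le_one) x)
    fun i t ht => ?_
  by_cases ht1 : t < 1
  · refine Or.inl ⟨r i, ?_⟩
    ext x
    simp only [Set.mem_setOf_eq]
    by_cases hx : x ∈ rect (r i)
    · rw [Set.indicator_of_mem hx, Pi.one_apply]
      exact ⟨fun _ => hx, fun _ => ht1⟩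
    · rw [Set.indicator_of_notMem hx]
      exact ⟨fun h => absurd h (not_lt.2 ht), fun h => absurd h hx⟩
  · refine Or.inr (Set.eq_empty_of_forall_notMem fun x hx => ?_)
    have h1 : (rect (r i)).indicator (1 : (κ → I) → ℝ) x ≤ 1 :=
      Set.indicator_le_self' (fun _ _ => zero_le_one) x
    exact ht1 (lt_of_lt_of_le hx h1)

end SahiRectangles

end Summit.CriticalPhenomena.PercolationContinuityZ3.Theorems
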